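import Summits.RiemannHypothesis.RiemannHypothesis.Theorems.TiltedLandingLaw421R3GainTwoPoint

/-!
# W-09 far branch · «FarTwoPointM» — the exact far two-point law for a state of ANY multiplicity (C4 kernel desk rh-idea-6 g43; SCRATCH)

SUPPORT (K only; asserts no law; RH is NOT proved; ⟨33346⟩/⟨33347⟩ OPEN).  ONE import (#1251 «FarTwoPoint», for its cone: the tree's
genus-one zero form `Literature.Analysis.Complex.GenusOneLogDerivC3g41.logDeriv_sub_logDeriv_eq_tsum_zeros`, `hadamard_genus_one_zeros`,
`growth_nonneg_exponent`, `growth_translate`, `hasSum_fiber_ncard`, `analyticOrderNatAt_pos_of_zero`, and `RhW08.FLinkGain.lineRem_eq`).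

★M `farList_twoPoint_mult`: #1251's ★ WITHOUT the simplicity hypothesis `f⁽ʲ⁺¹⁾ v ≠ 0` and WITHOUT the half-plane binders: for a legal frame
and an `R/2`-isolated state `v` (`0 < Im v`) of multiplicity `m ≥ 1`, ONE unpaired far list `(aᵢ)` (zeros of `f⁽ʲ⁾` other than `v, v̄`, each
listed with its multiplicity) with the EXACT identity `lineRem z − lineRem z' = Σ'ᵢ (1/(z − aᵢ) − 1/(z' − aᵢ))` between ANY two non-zeros
`z, z'` of `f⁽ʲ⁾` (summable, and absolutely: `Σᵢ 1/(‖z − aᵢ‖·‖z' − aᵢ‖) < ∞`, the tree's norm majorant `summable_twoPoint_terms`).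
No `dslope`: the zero form is applied to `f⁽ʲ⁾` itself (translated to a non-zero on the axis) and the `2m` near terms —
a FINITE sub-sum, `m` copies of `v` and of `v̄` by the multiplicity count — are moved to the left, where `lineRem_eq` expects them.
-/

noncomputable section

namespace RhW08.FarTwoPointM

open Complex Filter Topology Set
open scoped ComplexConjugate
open RhW08.Round1 RhW08.StSwap RhW08.Round2 RhW08.QuadW
open RhW08.SealSwap (PBot)
open RhW08.SealSwapQ RhW08.RateSplit RhW08.IsolatedTilt RhW08.FarStep RhW08.BurgersRate RhW08.PurseP RhW08.BurgersRateG3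
open RhIdea6.G17.W07C7 RhIdea6.G17.W07C7.Rev6 RhIdea6.G18.W07C8.Law421BirthS RhIdea6.G19.W07C11.Seam
open RhIdea6.G20.W07C12.Frac RhIdea6.G20.W07C12.StColP RhW07.C12.FieldSplit RhIdea6.G21.W07C13.TentMax
open RhW07.C14.TwoSided RhW07.C14.Classes RhW07.C14.Lineage RhW07.C14.Booking
open RhW08.FLink RhW08.FLinkGain RhW08.FLinkGainSeam
open RhW08.GainTwoPoint
open Literature.Analysis.Complex Literature.Analysis.Complex.GenusOneLogDerivC3g41
open Summit.RiemannHypothesis.RiemannHypothesis.Theorems.Splittings.JensenWindow (RealEntireLt2)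

/-- (K) a finite fibre sum: over the indices `n` with `b n = α⁻¹` a function of `(b n)⁻¹` is constant, so the sum is `ncard • value`. -/
theorem finsum_fiber_const {b : ℕ → ℂ} {α : ℂ} (hfin : ({n : ℕ | b n = α⁻¹} : Set ℕ).Finite) (T : ℂ → ℂ) :
    ∑ n ∈ hfin.toFinset, T (b n)⁻¹ = ({n : ℕ | b n = α⁻¹} : Set ℕ).ncard * T α := by
  rw [Set.ncard_eq_toFinset_card _ hfin]
  have h : ∀ n ∈ hfin.toFinset, T (b n)⁻¹ = T α := by
    intro n hn
    rw [Set.Finite.mem_toFinset, Set.mem_setOf_eq] at hn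
    rw [hn, inv_inv]
  rw [Finset.sum_congr rfl h, Finset.sum_const, nsmul_eq_mul]

/-- ★M (K) **THE EXACT FAR TWO-POINT LAW AT ANY MULTIPLICITY.** -/
theorem farList_twoPoint_mult {η : ℝ} {f : ℂ → ℂ} {x₀ s hmax R Hs : ℝ} {B : ℕ} (hE : EngineHyps5 2 η f x₀ s hmax R Hs B)
    {j : ℕ} {v : ℂ} (hFv : iteratedDeriv j f v = 0) (hv0 : 0 < v.im)
    (hiso : ∀ z : ℂ, iteratedDeriv j f z = 0 → |z.re - v.re| < R / 2 → z = v ∨ z = conj v) :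
    ∃ (ι : Type) (a : ι → ℂ),
      (∀ i, iteratedDeriv j f (a i) = 0 ∧ R / 2 ≤ |(a i).re - v.re|) ∧
      (∀ z, iteratedDeriv j f z = 0 → z ≠ v → z ≠ conj v → ∃ i, z = a i) ∧
      (∀ c, c ≠ v → c ≠ conj v → {i | a i = c}.ncard = analyticOrderNatAt (iteratedDeriv j f) c) ∧
      (∀ g : ℂ → ℝ, Summable (fun i ↦ g (a i)) →
        HasSum (fun c : ℂ ↦ (if c = v ∨ c = conj v then (0 : ℝ) else (analyticOrderNatAt (iteratedDeriv j f) c : ℝ)) * g c)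
          (∑' i, g (a i))) ∧
      ∀ z z' : ℂ, iteratedDeriv j f z ≠ 0 → iteratedDeriv j f z' ≠ 0 →
        Summable (fun i ↦ 1 / (‖z - a i‖ * ‖z' - a i‖)) ∧
        Summable (fun i ↦ (1 / (z - a i) - 1 / (z' - a i))) ∧
        lineRem f j v R z - lineRem f j v R z' = ∑' i, (1 / (z - a i) - 1 / (z' - a i)) := by
  -- the level `F = f⁽ʲ⁾`: entire, of growth order `< 2`
  set F : ℂ → ℂ := iteratedDeriv j f with hFdef
  have hFd : Differentiable ℂ F := differentiable_level hE j
  have hGr : RealEntireLt2 F := RhW08.WindowLoss.realEntireLt2_iteratedDeriv (RhW08.Column.realEntireLt2_of_hyps hE) j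
  obtain ⟨ρ, C, hρ0, hρ, hgr⟩ := hGr.growth
  have hR : 0 < R := RhW08.ClusterQ.R_pos_of_engine hE
  have hderivF : deriv F = iteratedDeriv (j + 1) f := by rw [hFdef, ← iteratedDeriv_succ]
  have hvc : v ≠ conj v := ne_conj_of_im_pos hv0
  have hFcv : F (conj v) = 0 := by
    show iteratedDeriv j f (conj v) = 0
    rw [iteratedDeriv_conj hE, show iteratedDeriv j f v = 0 from hFv, map_zero]
  -- a non-zero on the axis: `c₀ = Re v + i·Im v/2` (isolation)
  set c₀ : ℂ := ⟨v.re, v.im / 2⟩ with hc₀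
  have hc₀v : c₀ ≠ v := by
    intro h
    have := congrArg Complex.im h
    simp [hc₀] at this
    linarith
  have hc₀cv : c₀ ≠ conj v := by
    intro h
    have := congrArg Complex.im h
    simp [hc₀] at this
    linarith
  have hF0 : F c₀ ≠ 0 := by
    intro h0
    rcases hiso c₀ h0 (by simp [hc₀]; linarith) with h | h
    · exact hc₀v h
    · exact hc₀cv h
  -- the translate `G x = F (x + c₀)` and its Hadamard datum
  obtain ⟨C₁, hC₁, hg₁⟩ := growth_nonneg_exponent hFd hgr
  set σ : ℝ := max ρ 0 with hσ
  have hσ0 : 0 ≤ σ := le_max_right _ _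
  have hσ2 : σ < 2 := max_lt hρ (by norm_num)
  set G : ℂ → ℂ := fun x ↦ F (x + c₀) with hGdef
  have hGd : Differentiable ℂ G := hFd.comp (differentiable_id.add_const c₀)
  set σ' : ℝ := (σ + 2) / 2 with hσ'
  have hσσ' : σ < σ' := by rw [hσ']; linarith
  have hσ'2 : σ' < 2 := by rw [hσ']; linarith
  obtain ⟨C₂, hg₂⟩ := growth_translate hσ0 hC₁ hg₁ c₀ hσσ'
  have hG0 : G 0 ≠ 0 := by simpa [hGdef] using hF0
  obtain ⟨b, hb, hzero, hmult, hprod⟩ := hadamard_genus_one_zeros G σ' C₂ hGd hσ'2 hg₂ hG0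
  -- multiplicities of `F` read off the datum: the fibre of `c` among genuine inverse zeros has `ord_c F` elements
  have hcompN : ∀ c : ℂ, analyticOrderNatAt G (c - c₀) = analyticOrderNatAt F c := by
    intro c
    unfold analyticOrderNatAt
    congr 1
    have hG' : G = F ∘ (fun x ↦ x + c₀) := rfl
    rw [hG', analyticOrderAt_comp_of_deriv_ne_zero (by fun_prop) (by simp), sub_add_cancel]
  have hcardN : ∀ c : ℂ, c ≠ c₀ → ({n : ℕ | b n = (c - c₀)⁻¹} : Set ℕ).ncard = analyticOrderNatAt F c := by
    intro c hc
    rw [← hcompN]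
    exact hmult (c - c₀) (sub_ne_zero.2 hc)
  have hposN : ∀ c : ℂ, F c = 0 → 0 < analyticOrderNatAt F c := by
    intro c hFc
    have hGc : G (c - c₀) = 0 := by simpa [hGdef] using hFc
    rw [← hcompN]
    exact analyticOrderNatAt_pos_of_zero hGd hG0 hGc
  have hfinN : ∀ c : ℂ, c ≠ c₀ → F c = 0 → ({n : ℕ | b n = (c - c₀)⁻¹} : Set ℕ).Finite := by
    intro c hc hFc
    apply Set.finite_of_ncard_pos
    rw [hcardN c hc]
    exact hposN c hFc
  -- membership in a fibre, spelled out
  have hfib : ∀ (n : ℕ) (c : ℂ), c ≠ c₀ → (b n = (c - c₀)⁻¹ ↔ b n ≠ 0 ∧ (b n)⁻¹ + c₀ = c) := by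
    intro n c hc
    constructor
    · intro h
      refine ⟨by rw [h]; exact inv_ne_zero (sub_ne_zero.2 hc), ?_⟩
      rw [h, inv_inv, sub_add_cancel]
    · rintro ⟨-, h⟩
      rw [← h, add_sub_cancel_right, inv_inv]
  -- the FAR index type: genuine inverse zeros other than `v`, `v̄`
  set P : ℕ → Prop := fun n ↦ b n ≠ 0 ∧ (b n)⁻¹ + c₀ ≠ v ∧ (b n)⁻¹ + c₀ ≠ conj v with hP
  have hzeroF : ∀ n, b n ≠ 0 → F ((b n)⁻¹ + c₀) = 0 := fun n hn ↦ by simpa [hGdef] using hzero n hn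
  have hcardP : ∀ c : ℂ, c ≠ v → c ≠ conj v →
      ({i : {n : ℕ // P n} | (b i.1)⁻¹ + c₀ = c} : Set _).ncard = analyticOrderNatAt F c := by
    intro c hcv hccv
    by_cases hcc : c = c₀
    · -- `c₀` is a non-zero: empty fibre, order zero
      have hempty : ({i : {n : ℕ // P n} | (b i.1)⁻¹ + c₀ = c} : Set _) = ∅ := by
        ext i
        simp only [Set.mem_setOf_eq, Set.mem_empty_iff_false, iff_false]
        intro h
        exact hF0 (by rw [← hcc, ← h]; exact hzeroF i.1 i.2.1)
      rw [hempty, Set.ncard_empty]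
      unfold analyticOrderNatAt
      rw [hcc, ((hFd.analyticAt c₀).analyticOrderAt_eq_zero).2 hF0]
      simp
    · rw [← hcardN c hcc, show ({i : {n : ℕ // P n} | (b i.1)⁻¹ + c₀ = c} : Set _) =
          {i : {n : ℕ // P n} | (i : ℕ) ∈ {n : ℕ | (b n)⁻¹ + c₀ = c}} from rfl, Set.ncard_subtype]
      congr 1
      ext n
      simp only [Set.mem_inter_iff, Set.mem_setOf_eq, hfib n c hcc, hP]
      constructor
      · rintro ⟨h1, h2, -, -⟩
        exact ⟨h2, h1⟩
      · rintro ⟨h1, h2⟩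
        exact ⟨h2, h1, by rw [h2]; exact hcv, by rw [h2]; exact hccv⟩
  refine ⟨{n : ℕ // P n}, fun i ↦ (b i.1)⁻¹ + c₀, fun i ↦ ?_, fun z hz hzv hzcv ↦ ?_, hcardP, fun g hg ↦ ?_,
    fun z z' hz hz' ↦ ?_⟩
  · -- far zeros
    refine ⟨hzeroF i.1 i.2.1, ?_⟩
    by_contra hlt
    rw [not_le] at hlt
    rcases hiso _ (hzeroF i.1 i.2.1) hlt with h | h
    · exact i.2.2.1 h
    · exact i.2.2.2 h
  · -- every zero other than `v`, `v̄` is listed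
    have hzc : z ≠ c₀ := by intro e; rw [e] at hz; exact hF0 hz
    have hne : ({n : ℕ | b n = (z - c₀)⁻¹} : Set ℕ).ncard ≠ 0 := by
      rw [hcardN z hzc]
      exact (hposN z hz).ne'
    obtain ⟨n, hn⟩ := Set.nonempty_of_ncard_ne_zero hne
    rw [Set.mem_setOf_eq, hfib n z hzc] at hn
    exact ⟨⟨n, hn.1, by rw [hn.2]; exact hzv, by rw [hn.2]; exact hzcv⟩, hn.2.symm⟩
  · -- multiplicity export
    have h2 := hasSum_fiber_ncard (fun i : {n : ℕ // P n} ↦ (b i.1)⁻¹ + c₀) g hg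
    have hfun : (fun c : ℂ ↦ (({i : {n : ℕ // P n} | (b i.1)⁻¹ + c₀ = c} : Set _).ncard : ℝ) * g c) =
        fun c ↦ (if c = v ∨ c = conj v then (0 : ℝ) else (analyticOrderNatAt F c : ℝ)) * g c := by
      funext c
      split_ifs with hc
      · have hempty : ({i : {n : ℕ // P n} | (b i.1)⁻¹ + c₀ = c} : Set _) = ∅ := by
          ext i
          simp only [Set.mem_setOf_eq, Set.mem_empty_iff_false, iff_false]
          intro h
          rcases hc with hc | hc
          · exact i.2.2.1 (h.trans hc)
          · exact i.2.2.2 (h.trans hc)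
        rw [hempty, Set.ncard_empty, Nat.cast_zero]
      · rw [not_or] at hc
        rw [hcardP c hc.1 hc.2]
    rw [hfun] at h2
    exact h2
  · -- the exact two-point identity with the `2m` near terms moved to the left
    have hGz : G (z - c₀) ≠ 0 := by simpa [hGdef] using hz
    have hGz' : G (z' - c₀) ≠ 0 := by simpa [hGdef] using hz'
    -- absolute summability of the two-point family over the far list (the tree's norm majorant, re-indexed as in #1250)
    have habs : Summable (fun i : {n : ℕ // P n} ↦ 1 / (‖z - ((b i.1)⁻¹ + c₀)‖ * ‖z' - ((b i.1)⁻¹ + c₀)‖)) := by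
      set g : ℕ → ℝ := fun n ↦ ‖b n‖ ^ 2 / (‖1 - b n * (z - c₀)‖ * ‖1 - b n * (z' - c₀)‖) with hgdef
      have hgs : Summable g := summable_twoPoint_terms hb (z - c₀) (z' - c₀)
      have hgi : ∀ i : {n : ℕ // P n}, g i.1 = 1 / (‖z - ((b i.1)⁻¹ + c₀)‖ * ‖z' - ((b i.1)⁻¹ + c₀)‖) := by
        intro i
        have hb0 : b i.1 ≠ 0 := i.2.1
        have e1 : ∀ u : ℂ, ‖1 - b i.1 * (u - c₀)‖ = ‖b i.1‖ * ‖u - ((b i.1)⁻¹ + c₀)‖ := by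
          intro u
          rw [← norm_mul, ← norm_neg (b i.1 * _)]
          congr 1
          field_simp
          ring
        simp only [hgdef, e1]
        have hbpos : 0 < ‖b i.1‖ := norm_pos_iff.2 hb0
        field_simp
      exact (hgs.subtype {n : ℕ | P n}).congr fun i ↦ hgi i
    obtain ⟨hS, hI⟩ := logDeriv_sub_logDeriv_eq_tsum_zeros hG0 hb hprod hGz hGz' (hGd _) (hGd _)
    have hlogG : ∀ x : ℂ, logDeriv G x = levelField f j (x + c₀) := by
      intro x
      rw [logDeriv_apply, hGdef, levelField]
      simp only [deriv_comp_add_const]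
      rw [hderivF]
    rw [hlogG, hlogG] at hI
    simp only [sub_add_cancel] at hI
    -- the terms
    set T : ℂ → ℂ := fun u ↦ 1 / (z - u) - 1 / (z' - u) with hT
    set gc : ℕ → ℂ := fun n ↦ ((mult b n : ℝ) : ℂ) * (1 / (z - c₀ - (b n)⁻¹) - 1 / (z' - c₀ - (b n)⁻¹)) with hgcdef
    have hgcT : ∀ n, b n ≠ 0 → gc n = T ((b n)⁻¹ + c₀) := by
      intro n hn
      have hm : mult b n = 1 := by simp [mult, hn]
      simp only [hgcdef, hT, hm, Complex.ofReal_one, one_mul]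
      congr 2 <;> ring
    have hgc0 : ∀ n, b n = 0 → gc n = 0 := by
      intro n hn
      simp [hgcdef, mult, hn]
    -- the two near fibres (finite, disjoint) and the far set
    have hvc₀ : v ≠ c₀ := fun h ↦ hc₀v h.symm
    have hcvc₀ : conj v ≠ c₀ := fun h ↦ hc₀cv h.symm
    have hNv : ({n : ℕ | b n = (v - c₀)⁻¹} : Set ℕ).Finite := hfinN v hvc₀ hFv
    have hNcv : ({n : ℕ | b n = (conj v - c₀)⁻¹} : Set ℕ).Finite := hfinN (conj v) hcvc₀ hFcv
    have hdisj : Disjoint hNv.toFinset hNcv.toFinset := by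
      rw [Finset.disjoint_left]
      intro n h1 h2
      rw [Set.Finite.mem_toFinset, Set.mem_setOf_eq] at h1 h2
      have : (v - c₀)⁻¹ = (conj v - c₀)⁻¹ := h1.symm.trans h2
      exact hvc (by simpa [sub_left_inj] using inv_injective this)
    set NEAR : Finset ℕ := hNv.toFinset ∪ hNcv.toFinset with hNEAR
    set gfar : ℕ → ℂ := ({n : ℕ | P n} : Set ℕ).indicator gc with hgfar
    set gnear : ℕ → ℂ := (↑NEAR : Set ℕ).indicator gc with hgnear
    have hmemNEAR : ∀ n, n ∈ NEAR ↔ b n ≠ 0 ∧ ((b n)⁻¹ + c₀ = v ∨ (b n)⁻¹ + c₀ = conj v) := by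
      intro n
      rw [hNEAR, Finset.mem_union, Set.Finite.mem_toFinset, Set.Finite.mem_toFinset, Set.mem_setOf_eq, Set.mem_setOf_eq,
        hfib n v hvc₀, hfib n (conj v) hcvc₀]
      tauto
    have hsplit : ∀ n, gc n = gfar n + gnear n := by
      intro n
      by_cases hb0 : b n = 0
      · have h1 : n ∉ ({n : ℕ | P n} : Set ℕ) := fun h ↦ h.1 hb0
        have h2 : n ∉ (↑NEAR : Set ℕ) := fun h ↦ ((hmemNEAR n).mp (Finset.mem_coe.mp h)).1 hb0
        rw [hgfar, hgnear, Set.indicator_of_notMem h1, Set.indicator_of_notMem h2, hgc0 n hb0, add_zero]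
      · by_cases hnear : (b n)⁻¹ + c₀ = v ∨ (b n)⁻¹ + c₀ = conj v
        · have h1 : n ∉ ({n : ℕ | P n} : Set ℕ) := by
            rintro ⟨-, h, h'⟩
            rcases hnear with e | e
            · exact h e
            · exact h' e
          have h2 : n ∈ (↑NEAR : Set ℕ) := Finset.mem_coe.mpr ((hmemNEAR n).mpr ⟨hb0, hnear⟩)
          rw [hgfar, hgnear, Set.indicator_of_notMem h1, Set.indicator_of_mem h2, zero_add]
        · rw [not_or] at hnear
          have h1 : n ∈ ({n : ℕ | P n} : Set ℕ) := ⟨hb0, hnear.1, hnear.2⟩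
          have h2 : n ∉ (↑NEAR : Set ℕ) := fun h ↦ by
            rcases ((hmemNEAR n).mp (Finset.mem_coe.mp h)).2 with e | e
            · exact hnear.1 e
            · exact hnear.2 e
          rw [hgfar, hgnear, Set.indicator_of_mem h1, Set.indicator_of_notMem h2, add_zero]
    have hSfar : Summable gfar := hS.indicator _
    have hSnear : Summable gnear := hS.indicator _
    -- the near sum: `m T(v) + m̄ T(v̄)`
    have hnear : ∑' n, gnear n = (analyticOrderNatAt F v : ℂ) * T v + (analyticOrderNatAt F (conj v) : ℂ) * T (conj v) := by
      rw [tsum_eq_sum (s := NEAR) (fun n hn ↦ by rw [hgnear, Set.indicator_of_notMem (fun h ↦ hn (Finset.mem_coe.mp h))])]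
      rw [Finset.sum_congr rfl (fun n hn ↦ by rw [hgnear, Set.indicator_of_mem (Finset.mem_coe.mpr hn)]), hNEAR,
        Finset.sum_union hdisj]
      have hfib_sum : ∀ {c : ℂ} (hc : c ≠ c₀) (hfin : ({n : ℕ | b n = (c - c₀)⁻¹} : Set ℕ).Finite),
          ∑ n ∈ hfin.toFinset, gc n = (analyticOrderNatAt F c : ℂ) * T c := by
        intro c hc hfin
        have h1 : ∀ n ∈ hfin.toFinset, gc n = (fun x ↦ T (x + c₀)) (b n)⁻¹ := by
          intro n hn
          rw [Set.Finite.mem_toFinset, Set.mem_setOf_eq] at hn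
          exact hgcT n (by rw [hn]; exact inv_ne_zero (sub_ne_zero.2 hc))
        rw [Finset.sum_congr rfl h1, finsum_fiber_const hfin (fun x ↦ T (x + c₀)), hcardN c hc, sub_add_cancel]
      rw [hfib_sum hvc₀ hNv, hfib_sum hcvc₀ hNcv]
    -- the far sum, re-indexed by the far type
    have hsupp : Function.support gfar ⊆ {n : ℕ | P n} := by
      rw [hgfar]
      exact Set.support_indicator_subset
    have hgi : ∀ i : {n : ℕ // P n}, gfar i.1 = T ((b i.1)⁻¹ + c₀) := by
      intro i
      rw [hgfar, Set.indicator_of_mem (show i.1 ∈ {n : ℕ | P n} from i.2), hgcT i.1 i.2.1]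
    have hfar : ∑' i : {n : ℕ // P n}, T ((b i.1)⁻¹ + c₀) = ∑' n, gfar n := by
      rw [← tsum_subtype_eq_of_support_subset hsupp]
      exact tsum_congr fun i ↦ (hgi i).symm
    have hsumm : Summable fun i : {n : ℕ // P n} ↦ T ((b i.1)⁻¹ + c₀) := by
      have := hSfar.subtype {n : ℕ | P n}
      refine this.congr fun i ↦ ?_
      exact hgi i
    refine ⟨habs, hsumm, ?_⟩
    -- assembly
    have htot : levelField f j z - levelField f j z' = ∑' n, gfar n + ∑' n, gnear n := by
      rw [hI, ← hSfar.tsum_add hSnear]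
      exact tsum_congr hsplit
    rw [lineRem_eq hiso hFv hFcv hR hv0 z, lineRem_eq hiso hFv hFcv hR hv0 z', show ∑' i : {n : ℕ // P n},
        (1 / (z - ((b i.1)⁻¹ + c₀)) - 1 / (z' - ((b i.1)⁻¹ + c₀))) = ∑' i : {n : ℕ // P n}, T ((b i.1)⁻¹ + c₀) from rfl, hfar]
    have e1 : ∑' n, gfar n = (levelField f j z - levelField f j z') - ∑' n, gnear n := by rw [htot]; ring
    rw [e1, hnear]
    unfold analyticOrderNatAt
    simp only [hT, one_div]
    ring

end RhW08.FarTwoPointM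

end
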